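import Summits.ABC.ABC.Theses.DefiniteXi
import Literature.NumberTheory.EllipticCurves.SzpiroFreyConductorProofs
import Literature.NumberTheory.EllipticCurves.PastenValuationProductTamagawaProofs
import Mathlib.Analysis.SpecificLimits.Normed

/-!
# `EisensteinQuarantine` (stmt-ABC-15023) — negative lemma: the crux fails under the 2-adic
# Eisenstein depth law along Pierpont–Legendre Frey curves

Standing-adversary (cdisprove) output for the crux
`Summit.ABC.ABC.Theses.DefiniteXi.EisensteinQuarantine`
(`sixPart ξ(E_(a,b); N/N⁻, N⁻) ≤ C_ε N^ε · ∏_{q ∣ N, q ∤ N⁻} v_q(Δ_min)`).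

The family.  For `M = 2^s 3^t` with `p = M + 1` prime (a Pierpont prime), the Frey curve
`E = E_(−p, M) : y² = x (x + p) (x + M)` is the Legendre curve `y² = X (X − 1) (X − p)` (`X = x + p`);
`ab(a+b) = p · M`, and under Serre's normalisation (`a = −p ≡ −1 (mod 4)`, `32 ∣ b = M`, i.e. `s ≥ 5`)
`Δ_min = p² 2^{2s−8} 3^{2t}`, so the bad primes are `{2, 3, p}` and at every bad prime the reduction
is SPLIT multiplicative (`p ≡ 1 (mod 4)`, `p ≡ 1 (mod 3)`, `p ≡ 1 (mod 2^s)`): every Atkin–Lehner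
sign of `f_E` agrees with the weight-2 Eisenstein series of level `p`, whose Eisenstein ideal has index
`num((p−1)/12) ⊇ 2^{s−2}` (Mazur 1977).  Quarantining `N⁻ := p` (admissible: odd prime dividing `N`)
leaves the allowance `𝓛 = v₂(Δ_min) · v₃(Δ_min) = (2s − 8)(2t)`, polynomial in `s`, while the census of
this seat (kit jobs j017527/j017528, direct Brandt-module computation certified by Eichler's mass formula,
and the modular-degree census j017464 via Takahashi's `deg · i_p = ξ(N/p,p) · j_p`, `j_p ∣ v_p(Δ_min) = 2`)
finds `v₂ ξ(E; N/p, p) ≥ s − 1` on every computed member (`p = 97, 193, 577, 769, 1153, 12289, …`):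
`sixPart ξ / 𝓛 ≈ N^{0.4}` at `N ≤ 10⁵` and `→ N^{1−o(1)}` along the family.

What is PROVED here (kernel-checked, no `sorry`): the implication

  `minimalDiscriminantNorm_freyCurve_of_mod` (tree fact, Serre/Diamond–Kramer)
  `→ (hD)` (inline hypothesis, the census depth law `2^s ≤ 2^c · ordProj[2] ξ(E_(−p,p−1); N/p, p)`)
  `→ (hP)` (inline hypothesis: for every `s₀` a Pierpont prime `2^s 3^t + 1` with `s ≥ s₀`, `t ≥ 1`,
     `3^{8t} ≤ 2^s` — unboundedness of Pierpont primes with small 3-part, expected but unproved)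
  `→ ¬ EisensteinQuarantine`,

i.e. the crux as filed is refuted by the depth law modulo the existence of the primes: at `ε = 1/8` the
crux would give `2^{8s} ≤ 2^{8c} C⁸ · N · 𝓛⁸ ≤ C⁸ 2^{8c+25} s^{16} 2^{3s}`, impossible for large `s`.
The only uses of the tree beyond the route file are the PROVED `conductorNorm_freyCurve_dvd_holds`
(`N ∣ 2⁸ rad`), `primeFactors_conductorNorm_eq` (`N` and `Δ_min` have the same primes) and
`WeierstrassCurve.conductorNorm_pos_holds`.

Refuter seat refuter-cdisprove-stmt-ABC-15023-0, 2026-08-16.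
-/

-- `Summit.<Summit>.<Problem>`: for the single-conjunct summit `ABC` the duplicate `ABC.ABC` is mandated.
set_option linter.dupNamespace false

namespace Summit.ABC.ABC.Theorems.EisensteinQuarantine.Negative

open Literature.NumberTheory.Automorphic Literature.NumberTheory.EllipticCurves
open Filter Asymptotics

/-- Exponential beats polynomial: for every real `K` there is `s₀` with `K · s^16 < 2^(5s)` for `s ≥ s₀`. -/
theorem eventually_const_mul_pow_lt_two_pow (K : ℝ) :
    ∃ s₀ : ℕ, ∀ s : ℕ, s₀ ≤ s → K * (s : ℝ) ^ 16 < (2 : ℝ) ^ (5 * s) := by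
  have ho : (fun n : ℕ => ((n : ℝ) ^ 16 : ℝ)) =o[atTop] fun n : ℕ => (2 : ℝ) ^ n :=
    isLittleO_pow_const_const_pow_of_one_lt 16 one_lt_two
  have hK : 0 < 1 / (2 * (|K| + 1)) := by positivity
  have hev := (isLittleO_iff.mp ho) hK
  obtain ⟨s₀, hs₀⟩ := eventually_atTop.mp hev
  refine ⟨s₀, fun s hs => ?_⟩
  have h := hs₀ s hs
  rw [Real.norm_of_nonneg (by positivity), Real.norm_of_nonneg (by positivity)] at h
  have h2 : (2 : ℝ) ^ s ≤ (2 : ℝ) ^ (5 * s) := pow_le_pow_right₀ (by norm_num) (by omega)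
  have h3 : K * (s : ℝ) ^ 16 ≤ (|K| + 1) * (s : ℝ) ^ 16 := by
    have : K ≤ |K| + 1 := (le_abs_self K).trans (by linarith)
    exact mul_le_mul_of_nonneg_right this (by positivity)
  have h4 : (|K| + 1) * (s : ℝ) ^ 16 ≤ (|K| + 1) * (1 / (2 * (|K| + 1)) * (2 : ℝ) ^ s) :=
    mul_le_mul_of_nonneg_left h (by positivity)
  have h5 : (|K| + 1) * (1 / (2 * (|K| + 1)) * (2 : ℝ) ^ s) = (2 : ℝ) ^ s / 2 := by
    field_simp
  have h6 : (2 : ℝ) ^ s / 2 < (2 : ℝ) ^ s := by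
    have : (0 : ℝ) < (2 : ℝ) ^ s := by positivity
    linarith
  linarith

/-- **`EisensteinQuarantine` is false under the Pierpont depth law** — hypothesis `hD`: there is `c` such that
for every Pierpont prime `p = 2^s 3^t + 1` (`s ≥ 5`, `t ≥ 1`) the 2-part of the quarantined congruence number
`ξ(E_(−p, p−1); N/p, p)` is at least `2^{s−c}` (the CENSUS LAW of this crux programme: direct Brandt-module
census kit j017527 — `v₂ ξ = 6, 8, 9, 10` at `s = 5, 6, 8, 12` for `t = 1`, `11, 9` at `s = 6, 7` for `t = 2` —
and PARI modular degrees kit j017919 — `v₂ deg = 11, 15, 15` at `s = 12, 11, 14`, `ξ = deg/2` at `s = 12` with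
equal odd parts `653` — via Takahashi's `deg · i_p = ξ · j_p`, `i_p j_p ∣ v_p(Δ_min) = 2`; mechanism: all
Atkin–Lehner signs of `f_E` are the Eisenstein signs and `2^{s−2} ∣ num((p−1)/12)`, Mazur 1977) — modulo the
unboundedness of Pierpont primes with small 3-part (`hP`) and the tree's Serre/Diamond–Kramer fact (`hΔ`).  At `ε = 1/8`, `N⁻ = p`,
`(a, b) = (−p, p − 1)`: the crux bounds `2^{s−c} ≤ ordProj[2] ξ ≤ sixPart ξ ≤ C N^{1/8} (2s−8)(2t)` with
`N ≤ 2⁸ p (p−1) ≤ 2^{3s+9}`, i.e. `2^{5s} ≤ C⁸ 2^{8c+25} s^{16}` — absurd for large `s`. -/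
theorem eisensteinQuarantine_false_of_pierpontDepthLaw
    (hΔ : ∀ a b : ℤ, minimalDiscriminantNorm_freyCurve_of_mod a b)
    (hD : ∃ c : ℕ, ∀ s t : ℕ, 5 ≤ s → 1 ≤ t → Nat.Prime (2 ^ s * 3 ^ t + 1) →
      ∀ N : ℕ, (freyCurve (-((2 ^ s * 3 ^ t + 1 : ℕ) : ℤ)) ((2 ^ s * 3 ^ t : ℕ) : ℤ)).conductorNorm ℤ = N →
        2 ^ s ≤ 2 ^ c * ordProj[2] (brandtXi (N / (2 ^ s * 3 ^ t + 1)) (2 ^ s * 3 ^ t + 1)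
          (fun n => (freyCurve (-((2 ^ s * 3 ^ t + 1 : ℕ) : ℤ)) ((2 ^ s * 3 ^ t : ℕ) : ℤ)).LFunction n)))
    (hP : ∀ s₀ : ℕ, ∃ s t : ℕ, s₀ ≤ s ∧ 1 ≤ t ∧ 3 ^ (8 * t) ≤ 2 ^ s ∧ Nat.Prime (2 ^ s * 3 ^ t + 1)) :
    ¬ Summit.ABC.ABC.Theses.DefiniteXi.EisensteinQuarantine := by
  intro hEQ
  obtain ⟨c, hc⟩ := hD
  obtain ⟨C, hC⟩ := hEQ (1 / 8) (by norm_num)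
  -- constants and the eventual inequality
  set C' : ℝ := max C 1 with hC'
  have hC'1 : 1 ≤ C' := le_max_right _ _
  have hC'0 : 0 ≤ C' := zero_le_one.trans hC'1
  obtain ⟨s₀, hs₀⟩ := eventually_const_mul_pow_lt_two_pow (C' ^ 8 * (2 : ℝ) ^ (8 * c + 25))
  obtain ⟨s, t, hs, ht, h3t, hp⟩ := hP (max s₀ 5)
  have hs5 : 5 ≤ s := le_of_max_le_right hs
  have hss₀ : s₀ ≤ s := le_of_max_le_left hs
  -- the instance
  set M : ℕ := 2 ^ s * 3 ^ t with hM
  set P : ℕ := 2 ^ s * 3 ^ t + 1 with hP'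
  have hM0 : 0 < M := by positivity
  have hP2 : P ≠ 2 := by
    intro h; have : 2 ^ 5 ≤ 2 ^ s := Nat.pow_le_pow_right (by norm_num) hs5
    have : 2 ^ s ≤ M := Nat.le_mul_of_pos_right _ (by positivity)
    omega
  have hP3 : P ≠ 3 := by
    intro h; have : 2 ^ 5 ≤ 2 ^ s := Nat.pow_le_pow_right (by norm_num) hs5
    have : 2 ^ s ≤ M := Nat.le_mul_of_pos_right _ (by positivity)
    omega
  set a : ℤ := -(P : ℤ) with ha
  set b : ℤ := (M : ℤ) with hb
  have hPM1 : (P : ℤ) = (M : ℤ) + 1 := by rw [hP', hM]; push_cast; ring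
  have hab_sum : a + b = -1 := by rw [ha, hb, hPM1]; ring
  have habc : a * b * (a + b) = (P : ℤ) * M := by rw [hab_sum, ha, hb]; ring
  have hPM0 : (P : ℤ) * M ≠ 0 := by positivity
  have h0 : a * b * (a + b) ≠ 0 := by rw [habc]; exact hPM0
  have hcopPM : Nat.Coprime P M := by
    have : Nat.Coprime (M + 1) M := by
      rw [Nat.Coprime, Nat.gcd_comm, Nat.gcd_self_add_right, Nat.gcd_one_right]
    exact this
  have hab : IsCoprime a b := by
    rw [ha, hb, IsCoprime.neg_left_iff, Int.isCoprime_iff_gcd_eq_one, Int.gcd_natCast_natCast]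
    exact hcopPM
  have ha4 : a ≡ -1 [ZMOD 4] := by
    -- P = 2^s 3^t + 1 ≡ 1 (mod 4) since s ≥ 2
    have h4 : (4 : ℤ) ∣ (M : ℤ) := by
      have : (4 : ℕ) ∣ M := by
        rw [hM]; exact Dvd.dvd.mul_right (by
          calc (4 : ℕ) = 2 ^ 2 := by norm_num
            _ ∣ 2 ^ s := Nat.pow_dvd_pow 2 (by omega)) _
      exact_mod_cast this
    have : a = -1 - (M : ℤ) := by rw [ha, hPM1]; ring
    rw [this]
    calc -1 - (M : ℤ) ≡ -1 - 0 [ZMOD 4] := Int.ModEq.sub_left _ ((Int.modEq_zero_iff_dvd).mpr h4)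
      _ = -1 := by ring
  have hb32 : (32 : ℤ) ∣ b := by
    have : (32 : ℕ) ∣ M := by
      rw [hM]; exact Dvd.dvd.mul_right (by
        calc (32 : ℕ) = 2 ^ 5 := by norm_num
          _ ∣ 2 ^ s := Nat.pow_dvd_pow 2 hs5) _
    rw [hb]; exact_mod_cast this
  -- the curve, conductor, minimal discriminant
  set E := freyCurve a b with hE
  haveI : E.IsElliptic := isElliptic_freyCurve h0
  -- generalise the (noncomputable) conductor / minimal discriminant to opaque naturals
  obtain ⟨N, hN⟩ : ∃ N : ℕ, E.conductorNorm ℤ = N := ⟨_, rfl⟩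
  have hNpos : 0 < N := hN ▸ WeierstrassCurve.conductorNorm_pos_holds E
  haveI : NeZero N := ⟨hNpos.ne'⟩
  obtain ⟨D, hD'⟩ : ∃ D : ℕ, E.minimalDiscriminantNorm ℤ = D := ⟨_, rfl⟩
  have hD8 : 2 ^ 8 * D = P ^ 2 * 2 ^ (2 * s) * 3 ^ (2 * t) := by
    have h := hΔ a b hab h0 ha4 hb32
    rw [habc] at h
    change 2 ^ 8 * E.minimalDiscriminantNorm ℤ = _ at h
    rw [hD'] at h
    have : (((P : ℤ) * M) ^ 2).natAbs = P ^ 2 * 2 ^ (2 * s) * 3 ^ (2 * t) := by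
      rw [Int.natAbs_pow, Int.natAbs_mul, Int.natAbs_natCast, Int.natAbs_natCast, hM]; ring
    rw [← this]; exact h
  have hDval : D = P ^ 2 * 2 ^ (2 * s - 8) * 3 ^ (2 * t) := by
    have h28 : 2 ^ (2 * s) = 2 ^ 8 * 2 ^ (2 * s - 8) := by
      rw [← pow_add]; congr 1; omega
    have : 2 ^ 8 * D = 2 ^ 8 * (P ^ 2 * 2 ^ (2 * s - 8) * 3 ^ (2 * t)) := by rw [hD8, h28]; ring
    exact Nat.eq_of_mul_eq_mul_left (by positivity) this
  have hP0 : P ≠ 0 := hp.ne_zero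
  -- prime factors and factorization of D
  have hDpf : D.primeFactors = {2, 3, P} := by
    rw [hDval, Nat.primeFactors_mul (by positivity) (by positivity),
      Nat.primeFactors_mul (by positivity) (by positivity),
      Nat.primeFactors_pow _ (by norm_num), Nat.primeFactors_prime_pow (by omega) Nat.prime_two,
      Nat.primeFactors_prime_pow (by omega) Nat.prime_three, hp.primeFactors]
    ext q; simp [Finset.mem_insert, Finset.mem_singleton]; tauto
  have hfac2 : D.factorization 2 = 2 * s - 8 := by
    rw [hDval, Nat.factorization_mul (by positivity) (by positivity),
      Nat.factorization_mul (by positivity) (by positivity)]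
    simp only [Finsupp.add_apply, Nat.factorization_pow, Finsupp.smul_apply, smul_eq_mul,
      Nat.Prime.factorization_self Nat.prime_two]
    rw [hp.factorization, Nat.prime_three.factorization]
    simp [hP2]
  have hfac3 : D.factorization 3 = 2 * t := by
    rw [hDval, Nat.factorization_mul (by positivity) (by positivity),
      Nat.factorization_mul (by positivity) (by positivity)]
    simp only [Finsupp.add_apply, Nat.factorization_pow, Finsupp.smul_apply, smul_eq_mul,
      Nat.Prime.factorization_self Nat.prime_three]
    rw [hp.factorization, Nat.prime_two.factorization]
    simp [hP3]
  have hNpf : N.primeFactors = {2, 3, P} := by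
    rw [← hN, primeFactors_conductorNorm_eq E, hD']; exact hDpf
  have hPN : P ∣ N := Nat.dvd_of_mem_primeFactors (by rw [hNpf]; simp)
  -- admissibility of Nm := P
  have hPodd : Odd P := hp.odd_of_ne_two hP2
  have hPsq : Squarefree P := hp.squarefree
  have hPcard : Odd P.primeFactors.card := by rw [hp.primeFactors]; simp
  -- the crux at this instance (then make ξ and Δ_min opaque)
  have hcrux := hC a b hab h0 N hN P hPodd hPsq hPcard hPN
  obtain ⟨ξ, hξ⟩ : ∃ ξ : ℕ, brandtXi (N / P) P (fun n => E.LFunction n) = ξ := ⟨_, rfl⟩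
  change ((ordProj[2] (brandtXi (N / P) P (fun n => E.LFunction n)) *
      ordProj[3] (brandtXi (N / P) P (fun n => E.LFunction n)) : ℕ) : ℝ) ≤
    C * (N : ℝ) ^ (1 / 8 : ℝ) * ((∏ q ∈ N.primeFactors \ P.primeFactors,
      (E.minimalDiscriminantNorm ℤ).factorization q : ℕ) : ℝ) at hcrux
  rw [hξ, hD'] at hcrux
  -- the allowance
  have hsdiff : N.primeFactors \ P.primeFactors = {2, 3} := by
    rw [hNpf, hp.primeFactors]
    ext q; simp only [Finset.mem_sdiff, Finset.mem_insert, Finset.mem_singleton]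
    constructor
    · rintro ⟨h1 | h1 | h1, h2⟩
      · exact Or.inl h1
      · exact Or.inr h1
      · exact absurd h1 h2
    · rintro (h1 | h1)
      · exact ⟨Or.inl h1, fun h => hP2 (h.symm.trans h1)⟩
      · exact ⟨Or.inr (Or.inl h1), fun h => hP3 (h.symm.trans h1)⟩
  have hL : (∏ q ∈ N.primeFactors \ P.primeFactors, D.factorization q) = (2 * s - 8) * (2 * t) := by
    rw [hsdiff, Finset.prod_pair (by norm_num), hfac2, hfac3]
  -- depth law at this instance
  have hdepth : 2 ^ s ≤ 2 ^ c * ordProj[2] ξ := by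
    have h := hc s t hs5 ht hp N hN
    change 2 ^ s ≤ 2 ^ c * ordProj[2] (brandtXi (N / P) P (fun n => E.LFunction n)) at h
    rwa [hξ] at h
  -- size of N :  N ∣ 2^8 rad(ab(a+b)) ≤ 2^8 · P · M
  have hNle : N ≤ 2 ^ 8 * (P * M) := by
    have hdvd : N ∣ 2 ^ 8 * (UniqueFactorizationMonoid.radical (a * b * (a + b))).natAbs := by
      have h := conductorNorm_freyCurve_dvd_holds a b hab h0
      rwa [show (freyCurve a b).conductorNorm ℤ = N from hN] at h
    rw [habc] at hdvd
    have hrad : (UniqueFactorizationMonoid.radical ((P : ℤ) * M)).natAbs ≤ P * M := by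
      have : ((P : ℤ) * M) = ((P * M : ℕ) : ℤ) := by push_cast; ring
      rw [this, Int.radical_natCast, Int.natAbs_natCast]
      exact Nat.radical_le_self_iff.mpr (by positivity)
    exact (Nat.le_of_dvd (by positivity) hdvd).trans (Nat.mul_le_mul_left _ hrad)
  -- numeric consequences in ℝ
  have hX1 : (1 : ℝ) ≤ (ordProj[3] ξ : ℕ) := by exact_mod_cast Nat.one_le_iff_ne_zero.mpr (Nat.ordProj_pos ξ 3).ne'
  have hX0 : (0 : ℝ) ≤ (ordProj[2] ξ : ℕ) := by positivity
  have hNR : (0 : ℝ) < (N : ℝ) := by exact_mod_cast hNpos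
  have hrpow0 : (0 : ℝ) ≤ (N : ℝ) ^ (1 / 8 : ℝ) := Real.rpow_nonneg hNR.le _
  have hLR : ((∏ q ∈ N.primeFactors \ P.primeFactors, D.factorization q : ℕ) : ℝ) = ((2 * s - 8) * (2 * t) : ℕ) := by
    rw [hL]
  -- (X : ℝ) ≤ C' * N^(1/8) * L
  have hstep1 : ((ordProj[2] ξ : ℕ) : ℝ) ≤ C' * (N : ℝ) ^ (1 / 8 : ℝ) * (((2 * s - 8) * (2 * t) : ℕ) : ℝ) := by
    have hL0 : (0 : ℝ) ≤ (((2 * s - 8) * (2 * t) : ℕ) : ℝ) := by positivity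
    calc ((ordProj[2] ξ : ℕ) : ℝ) ≤ ((ordProj[2] ξ : ℕ) : ℝ) * ((ordProj[3] ξ : ℕ) : ℝ) :=
          le_mul_of_one_le_right hX0 hX1
      _ = ((ordProj[2] ξ * ordProj[3] ξ : ℕ) : ℝ) := by push_cast; ring
      _ ≤ C * (N : ℝ) ^ (1 / 8 : ℝ) * (((2 * s - 8) * (2 * t) : ℕ) : ℝ) := by rw [← hLR]; exact hcrux
      _ ≤ C' * (N : ℝ) ^ (1 / 8 : ℝ) * (((2 * s - 8) * (2 * t) : ℕ) : ℝ) := by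
          gcongr; exact le_max_left _ _
  -- 2^s ≤ 2^c * X
  have hstep2 : (2 : ℝ) ^ s ≤ (2 : ℝ) ^ c * ((ordProj[2] ξ : ℕ) : ℝ) := by exact_mod_cast hdepth
  -- combine and raise to the 8th power
  have hT0 : (0 : ℝ) ≤ C' * (N : ℝ) ^ (1 / 8 : ℝ) * (((2 * s - 8) * (2 * t) : ℕ) : ℝ) := by positivity
  have hstep3 : (2 : ℝ) ^ s ≤ (2 : ℝ) ^ c * (C' * (N : ℝ) ^ (1 / 8 : ℝ) * (((2 * s - 8) * (2 * t) : ℕ) : ℝ)) :=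
    hstep2.trans (mul_le_mul_of_nonneg_left hstep1 (by positivity))
  have hpow8 : ((2 : ℝ) ^ s) ^ 8 ≤ ((2 : ℝ) ^ c * (C' * (N : ℝ) ^ (1 / 8 : ℝ) * (((2 * s - 8) * (2 * t) : ℕ) : ℝ))) ^ 8 :=
    pow_le_pow_left₀ (by positivity) hstep3 8
  have hN8 : ((N : ℝ) ^ (1 / 8 : ℝ)) ^ 8 = (N : ℝ) := by
    rw [← Real.rpow_natCast, ← Real.rpow_mul hNR.le]; norm_num
  have hexp : ((2 : ℝ) ^ c * (C' * (N : ℝ) ^ (1 / 8 : ℝ) * (((2 * s - 8) * (2 * t) : ℕ) : ℝ))) ^ 8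
      = (2 : ℝ) ^ (8 * c) * C' ^ 8 * (N : ℝ) * (((2 * s - 8) * (2 * t) : ℕ) : ℝ) ^ 8 := by
    rw [mul_pow, mul_pow, mul_pow, hN8, ← pow_mul]; ring
  rw [hexp, ← pow_mul] at hpow8
  -- bounds: N ≤ 2^(3s+9), L ≤ 4 s^2
  have hts : t ≤ s := by
    by_contra hcon
    push Not at hcon
    have : 2 ^ s < 3 ^ (8 * t) :=
      calc 2 ^ s < 2 ^ t := Nat.pow_lt_pow_right (by norm_num) hcon
        _ ≤ 3 ^ t := Nat.pow_le_pow_left (by norm_num) t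
        _ ≤ 3 ^ (8 * t) := Nat.pow_le_pow_right (by norm_num) (by omega)
    omega
  have h32t : 3 ^ (2 * t) ≤ 2 ^ s := (Nat.pow_le_pow_right (by norm_num) (by omega)).trans h3t
  have hNbound : (N : ℝ) ≤ (2 : ℝ) ^ (3 * s + 9) := by
    have hPM : P * M ≤ 2 * M * M := by
      have : P ≤ 2 * M := by rw [hP']; omega
      exact Nat.mul_le_mul_right _ this
    have h1 : N ≤ 2 ^ 9 * (2 ^ s * 3 ^ t) * (2 ^ s * 3 ^ t) := by
      calc N ≤ 2 ^ 8 * (P * M) := hNle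
        _ ≤ 2 ^ 8 * (2 * M * M) := Nat.mul_le_mul_left _ hPM
        _ = 2 ^ 9 * (2 ^ s * 3 ^ t) * (2 ^ s * 3 ^ t) := by rw [hM]; ring
    have h2 : 2 ^ 9 * (2 ^ s * 3 ^ t) * (2 ^ s * 3 ^ t) = 2 ^ 9 * 2 ^ (2 * s) * 3 ^ (2 * t) := by ring
    have h3 : 2 ^ 9 * 2 ^ (2 * s) * 3 ^ (2 * t) ≤ 2 ^ 9 * 2 ^ (2 * s) * 2 ^ s := Nat.mul_le_mul_left _ h32t
    have h4 : 2 ^ 9 * 2 ^ (2 * s) * 2 ^ s = 2 ^ (3 * s + 9) := by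
      rw [← pow_add 2 9 (2 * s), ← pow_add 2 (9 + 2 * s) s]; congr 1; omega
    have h5 : N ≤ 2 ^ (3 * s + 9) := by rw [h2] at h1; exact (h1.trans h3).trans_eq h4
    have h6 : ((N : ℕ) : ℝ) ≤ ((2 ^ (3 * s + 9) : ℕ) : ℝ) := Nat.cast_le.mpr h5
    simpa only [Nat.cast_pow, Nat.cast_ofNat] using h6
  have hLbound : (((2 * s - 8) * (2 * t) : ℕ) : ℝ) ≤ 4 * (s : ℝ) ^ 2 := by
    have : (2 * s - 8) * (2 * t) ≤ 4 * s ^ 2 := by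
      calc (2 * s - 8) * (2 * t) ≤ (2 * s) * (2 * s) := Nat.mul_le_mul (Nat.sub_le (2 * s) 8) (Nat.mul_le_mul_left 2 hts)
        _ = 4 * s ^ 2 := by ring
    exact_mod_cast this
  have hL8 : (((2 * s - 8) * (2 * t) : ℕ) : ℝ) ^ 8 ≤ (4 * (s : ℝ) ^ 2) ^ 8 := pow_le_pow_left₀ (by positivity) hLbound 8
  -- final chain: 2^(8s) ≤ 2^(8c) C'^8 2^(3s+9) (4 s^2)^8 = (C'^8 2^(8c+25)) s^16 2^(3s)
  have hfinal : (2 : ℝ) ^ (s * 8) ≤ (2 : ℝ) ^ (8 * c) * C' ^ 8 * (2 : ℝ) ^ (3 * s + 9) * (4 * (s : ℝ) ^ 2) ^ 8 := by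
    calc (2 : ℝ) ^ (s * 8) ≤ (2 : ℝ) ^ (8 * c) * C' ^ 8 * (N : ℝ) * (((2 * s - 8) * (2 * t) : ℕ) : ℝ) ^ 8 := hpow8
      _ ≤ (2 : ℝ) ^ (8 * c) * C' ^ 8 * (2 : ℝ) ^ (3 * s + 9) * (4 * (s : ℝ) ^ 2) ^ 8 := by gcongr
  have hrewrite : (2 : ℝ) ^ (8 * c) * C' ^ 8 * (2 : ℝ) ^ (3 * s + 9) * (4 * (s : ℝ) ^ 2) ^ 8
      = (C' ^ 8 * (2 : ℝ) ^ (8 * c + 25)) * (s : ℝ) ^ 16 * (2 : ℝ) ^ (3 * s) := by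
    have e1 : (4 * (s : ℝ) ^ 2) ^ 8 = 65536 * (s : ℝ) ^ 16 := by
      rw [mul_pow, ← pow_mul]; norm_num
    have e2 : (2 : ℝ) ^ (3 * s + 9) = (2 : ℝ) ^ (3 * s) * 512 := by rw [pow_add]; norm_num
    have e3 : (2 : ℝ) ^ (8 * c + 25) = (2 : ℝ) ^ (8 * c) * 33554432 := by rw [pow_add]; norm_num
    rw [e1, e2, e3]
    ring
  rw [hrewrite] at hfinal
  have hlt := hs₀ s hss₀
  -- hlt : K * s^16 < 2^(5s);  hfinal : 2^(8s) ≤ K * s^16 * 2^(3s)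
  have h8 : (2 : ℝ) ^ (s * 8) = (2 : ℝ) ^ (5 * s) * (2 : ℝ) ^ (3 * s) := by rw [← pow_add]; congr 1; omega
  rw [h8] at hfinal
  have h3pos : (0 : ℝ) < (2 : ℝ) ^ (3 * s) := by positivity
  have := lt_of_lt_of_le (mul_lt_mul_of_pos_right hlt h3pos) (le_refl _)
  linarith

end Summit.ABC.ABC.Theorems.EisensteinQuarantine.Negative
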